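/-
Copyright (c) 2026 the pub-hodgecm-mathlib formalisation cell (harness21).  Prover seat hodgecm-mathlib-LH7-p05 (g3), Track B «K2-LIT» ∕ hLiu418 #184♮ =
`stmt-HodgeConjecture-24832`, socket #41 KIND 1 a♮, the (dec) road in the `D`-currency: sub-brick (L5-ii) of K2Liu-p03 (g8)'s (L5-den)
`K2LiuKindOneSingularShellSize.norm_prod_shell_le_den` (his SIG 2026-09-05T01:55:13Z, bytes frozen) — «THE LOCAL SHELL POLYNOMIAL IS BOUNDED BY A POWER OF `q^m`».
THEOREMS ONLY (no `def`, no `instance`, no notation, no named-fact hypothesis, no `sorry`); pure Mathlib; lane `--supports stmt-HodgeConjecture-24832 --as helper`.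
-/
import Mathlib.Analysis.SpecialFunctions.Pow.Real
import Mathlib.Analysis.SpecialFunctions.Pow.Complex
import HarnessLib

/-!
# Crux `HLiu418`, socket #41, KIND 1 a♮ (dec) — `K2LiuTwistedPolyBound`: `‖Σ_{k≤m} (ε q^{1−2s})^k‖ ≤ (q^m)^c` FOR `c ≥ 2 + 2|re s|`

Cell `hodgecm-mathlib`, crux item hLiu418 = `stmt-HodgeConjecture-24832` (helper lane, count-neutral; closes no socket).  Namespace
`Summit.HodgeConjecture.HodgeConjecture.Cruxes.HLiu418.K2LiuTwistedPolyBound`.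

WHY.  The shell factor of the singular tail of record (★ p863805 ∕ ★ p864217) at a place `v ∈ D S h` is the K1-a♮ polynomial `Σ_{k ≤ mτ S v} (ε_v q_v^{1−2s})^k`
(`ε_v` a root of unity or `0`, `q_v` the residue cardinality).  The (L5-den) size letter `‖∏_{v∈D S h} …‖ ≤ C·(1+τa S)^{N₄}·D^{N₅}` (K2Liu-p03 (g8)) multiplies the
per-place bound of THIS FILE over `v` and then counts `∏_v q_v^{m_v} ≤ |N_{L⁺∕ℚ}((D d₀)·τ)|`:
* **`norm_twistedPoly_le`** — for `‖ε‖ ≤ 1`, `2 ≤ q`, any `m`, any `s`, and any natural `c ≥ 2 + 2|re s|`: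
  `‖Σ_{k<m+1} (ε·q^{1−2s})^k‖ ≤ (q^m)^c`.  Proof: `‖ε q^{1−2s}‖ ≤ q^{1−2 re s} ≤ q^{1+2|re s|} =: Q ≥ 1` (Mathlib `Complex.norm_natCast_cpow_of_pos`), so the sum is
  `≤ (m+1)·Q^m ≤ q^m·q^{(1+2|re s|)m} = q^{(2+2|re s|)m} ≤ q^{cm}` (`m+1 ≤ 2^m ≤ q^m`).
* tool: `norm_eps_mul_cpow_le` (the bound on one summand's base); `m + 1 ≤ 2^m ≤ q^m` inline (Mathlib `Nat.lt_two_pow_self`).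
References: [Tan1999, §4 Prop. 4.8 (the local factors at the bad places)]; [KudlaRallis1994, §2 (2.10)–(2.12)].
HONEST LABEL: HC_CM is proved only modulo the 7 printed citations (2 remaining named inputs: hLiu418 = stmt-HodgeConjecture-24832, h413 = stmt-HodgeConjecture-24833) until
rung 0 closes; count-neutral helper (`--supports stmt-HodgeConjecture-24832 --as helper`), closes no socket, moves no counter.
-/

set_option autoImplicit false
set_option linter.dupNamespace false -- the mandated namespace repeats `HodgeConjecture.HodgeConjecture`

noncomputable section

namespace Summit.HodgeConjecture.HodgeConjecture.Cruxes.HLiu418.K2LiuTwistedPolyBound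

/-- THE BASE OF ONE SUMMAND: `‖ε · q^{1−2s}‖ ≤ q^{1 + 2|re s|}` for `‖ε‖ ≤ 1`, `1 ≤ q` (Mathlib `Complex.norm_natCast_cpow_of_pos`: `‖q^{w}‖ = q^{re w}`).
[cite: Tan1999, §4 Prop. 4.8] -/
theorem norm_eps_mul_cpow_le {ε : ℂ} (hε : ‖ε‖ ≤ 1) {q : ℕ} (hq : 1 ≤ q) (s : ℂ) :
    ‖ε * (q : ℂ) ^ (1 - 2 * s)‖ ≤ (q : ℝ) ^ (1 + 2 * |s.re|) := by
  have hq0 : 0 < q := hq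
  have hq1 : (1 : ℝ) ≤ q := by exact_mod_cast hq
  rw [norm_mul, Complex.norm_natCast_cpow_of_pos hq0]
  have hre : (1 - 2 * s).re = 1 - 2 * s.re := by simp
  rw [hre]
  have hexp : 1 - 2 * s.re ≤ 1 + 2 * |s.re| := by
    have := neg_abs_le s.re
    linarith
  calc ‖ε‖ * (q : ℝ) ^ (1 - 2 * s.re) ≤ 1 * (q : ℝ) ^ (1 + 2 * |s.re|) :=
        mul_le_mul hε (Real.rpow_le_rpow_of_exponent_le hq1 hexp) (Real.rpow_nonneg (Nat.cast_nonneg q) _) zero_le_one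
    _ = (q : ℝ) ^ (1 + 2 * |s.re|) := one_mul _

/-- **THE LOCAL SHELL POLYNOMIAL IS BOUNDED BY A POWER OF `q^m`** (K2Liu-p03 (g8)'s (L5-ii) SIG, 2026-09-05T01:55:13Z): for `‖ε‖ ≤ 1`, `2 ≤ q`, any `m : ℕ`, any
`s : ℂ` and any natural `c` with `2 + 2|re s| ≤ c`, `‖Σ_{k<m+1} (ε · q^{1−2s})^k‖ ≤ (q^m)^c`.  Proof: each summand has norm `≤ Q^k ≤ Q^m`, `Q := q^{1+2|re s|} ≥ 1`; the
sum is `≤ (m+1)·Q^m ≤ q^m · q^{(1+2|re s|)·m} = q^{(2+2|re s|)·m} ≤ q^{c·m} = (q^m)^c`. [cite: Tan1999, §4 Prop. 4.8] [cite: KudlaRallis1994, §2 (2.10)–(2.12)] -/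
theorem norm_twistedPoly_le :
    ∀ (ε : ℂ), ‖ε‖ ≤ 1 → ∀ {q : ℕ}, 2 ≤ q → ∀ (m : ℕ) (s : ℂ) {c : ℕ}, 2 + 2 * |s.re| ≤ (c : ℝ) →
      ‖∑ k ∈ Finset.range (m + 1), (ε * (q : ℂ) ^ (1 - 2 * s)) ^ k‖ ≤ ((q : ℝ) ^ m) ^ c := by
  intro ε hε q hq m s c hc
  have hq1 : 1 ≤ q := le_trans one_le_two hq
  have hq1r : (1 : ℝ) ≤ q := by exact_mod_cast hq1
  have hq0r : (0 : ℝ) ≤ q := Nat.cast_nonneg q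
  set Q : ℝ := (q : ℝ) ^ (1 + 2 * |s.re|) with hQ
  have hQ1 : 1 ≤ Q := Real.one_le_rpow hq1r (by positivity)
  have hx : ‖ε * (q : ℂ) ^ (1 - 2 * s)‖ ≤ Q := norm_eps_mul_cpow_le hε hq1 s
  -- the sum is at most `(m+1) · Q^m`
  have hsum : ‖∑ k ∈ Finset.range (m + 1), (ε * (q : ℂ) ^ (1 - 2 * s)) ^ k‖ ≤ (m + 1 : ℝ) * Q ^ m := by
    calc ‖∑ k ∈ Finset.range (m + 1), (ε * (q : ℂ) ^ (1 - 2 * s)) ^ k‖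
        ≤ ∑ k ∈ Finset.range (m + 1), ‖(ε * (q : ℂ) ^ (1 - 2 * s)) ^ k‖ := norm_sum_le _ _
      _ ≤ ∑ _k ∈ Finset.range (m + 1), Q ^ m := by
          refine Finset.sum_le_sum fun k hk => ?_
          rw [norm_pow]
          exact (pow_le_pow_left₀ (norm_nonneg _) hx k).trans
            (pow_le_pow_right₀ hQ1 (Nat.lt_succ_iff.1 (Finset.mem_range.1 hk)))
      _ = (m + 1 : ℝ) * Q ^ m := by rw [Finset.sum_const, Finset.card_range, nsmul_eq_mul]; push_cast; ring
  -- `m + 1 ≤ q^m` and `Q^m = q^{(1+2|re s|)·m}`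
  have hm : (m + 1 : ℝ) ≤ (q : ℝ) ^ (m : ℝ) := by
    rw [Real.rpow_natCast]
    exact_mod_cast (Nat.lt_two_pow_self).trans_le (Nat.pow_le_pow_left hq m)
  have hQm : Q ^ m = (q : ℝ) ^ ((1 + 2 * |s.re|) * m) := by
    rw [hQ, Real.rpow_mul hq0r, Real.rpow_natCast]
  have hexp : (m : ℝ) + (1 + 2 * |s.re|) * m ≤ (c : ℝ) * m := by
    have hm0 : (0 : ℝ) ≤ m := Nat.cast_nonneg m
    nlinarith
  calc ‖∑ k ∈ Finset.range (m + 1), (ε * (q : ℂ) ^ (1 - 2 * s)) ^ k‖ ≤ (m + 1 : ℝ) * Q ^ m := hsum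
    _ ≤ (q : ℝ) ^ (m : ℝ) * (q : ℝ) ^ ((1 + 2 * |s.re|) * m) := by
        rw [hQm]
        exact mul_le_mul_of_nonneg_right hm (Real.rpow_nonneg hq0r _)
    _ = (q : ℝ) ^ ((m : ℝ) + (1 + 2 * |s.re|) * m) := by rw [Real.rpow_add (by exact_mod_cast (lt_of_lt_of_le zero_lt_two hq))]
    _ ≤ (q : ℝ) ^ ((c : ℝ) * m) := Real.rpow_le_rpow_of_exponent_le hq1r hexp
    _ = ((q : ℝ) ^ m) ^ c := by rw [mul_comm, Real.rpow_mul hq0r, Real.rpow_natCast, Real.rpow_natCast]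

end Summit.HodgeConjecture.HodgeConjecture.Cruxes.HLiu418.K2LiuTwistedPolyBound

end
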